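import Literature.AlgebraicGeometry.Resolution.RegularHomComposition
import Literature.AlgebraicGeometry.Resolution.SeparatingTranscendenceBasis
import Mathlib.RingTheory.RegularLocalRing.Polynomial
import Mathlib.RingTheory.TensorProduct.MvPolynomial
import Mathlib.RingTheory.AlgebraicIndependent.Adjoin
import Mathlib.RingTheory.Localization.BaseChange
import Mathlib.FieldTheory.IntermediateField.Adjoin.Algebra
import HarnessLib

/-!
# Geometric regularity is stable under finitely generated extensions of the ground field
# (Stacks 0381 / EGA IV₂ 6.7.4); base change of regular homomorphisms along essentially finite
# type maps (Stacks 07C1)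

Topic: `Literature/AlgebraicGeometry/Resolution`. The Stacks Project, Tag 0381 (Lemma 10.166.1):
for a Noetherian algebra `F` over a field `k` the following are equivalent: (1) `F` is
geometrically regular over `k` [`k' ⊗_k F` regular for every finitely generated field extension
`k'/k`], (2) `k' ⊗_k F` is regular for every finite purely inseparable `k'/k`, … ; and Tag 07C1
(Lemma 15.42.3): "Let `R → Λ` be a regular ring map. For any finite type ring map `R → R'` the
base change `R' → Λ ⊗_R R'` is regular too." (The proof of 07C1: flatness is base change; the
fibre over a prime of `R'` over `𝔭` is `κ(𝔮) ⊗_{κ(𝔭)} (Λ ⊗_R κ(𝔭))` with `κ(𝔮)/κ(𝔭)` finitely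
generated, "Hence … by Lemma 10.166.1".) Matsumura, *Commutative Ring Theory*, §32, defines
geometric regularity with finite extensions only (`IsGeometricallyRegular`, `ExcellentRings.lean`);
this file PROVES that the finitely generated extensions come for free, and deduces 07C1 for
essentially finite type base change. Everything is PROVED; no new notions, no named facts.

Proof of the extension lemma (`IsGeometricallyRegular.isRegularRing_baseChange_of_fg`), for
`L/k` finitely generated: by `exists_purelyInseparable_isSeparablyGenerated`
(`SeparatingTranscendenceBasis.lean`; the classical separating transcendence basis after a finite
purely inseparable extension of the constants, Stacks 04KM/030W) there are a finite purely
inseparable `L'/L`, a subfield `l ⊆ L'` finite purely inseparable over `k` and `s ⊆ L'`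
algebraically independent over `l` with `L'/l(s)` finite separable. Then `l ⊗_k F` is regular
(hypothesis), `l(s) ⊗_k F = l(s) ⊗_l (l ⊗_k F)` is a localisation of the polynomial ring
`(l ⊗_k F)[s]`, regular, `L' ⊗_k F = L' ⊗_{l(s)} (l(s) ⊗_k F)` is regular (finite separable base
change, `IsRegularRing.tensorProduct_of_isSeparable_left`, `FormalFibresRegular.lean`), and
regularity descends along the faithfully flat `L ⊗_k F → L' ⊗_k F` (Stacks 07NG).

## Content (namespace `Literature.AlgebraicGeometry.Resolution`)

* `isNoetherianRing_of_faithfullyFlat` — Noetherianity descends along faithfully flat maps;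
  `isRegularRing_of_isRegularRing_baseChange_field'` — Stacks 07NG for a base change of fields,
  without a Noetherian hypothesis on the smaller ring.
* `isRegularRing_fractionRing_mvPolynomial_tensor` — `l(s) ⊗_l G` is regular for `G` regular
  (`l(s)` the rational function field in finitely many variables).
* `IsGeometricallyRegular.isRegularRing_baseChange_of_fg`,
  `IsGeometricallyRegular.baseChange_of_fg` — **Stacks 0381 (2) ⇒ (1)**: `L ⊗_k F` is regular,
  indeed geometrically regular over `L`, for every finitely generated field extension `L/k`.
* `IsRegularHom.baseChange_of_essFiniteType` — **Stacks 07C1** for an essentially finite type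
  base change `A → A'` (the residue fields of `A'` are finitely generated over those of `A`).

## Sources

* The Stacks Project, Tags 0381 (Lemma 10.166.1), 07C1 (Lemma 15.42.3), 04KM, 07NG.
  [StacksProject]
* A. Grothendieck, EGA IV₂, Prop. 6.7.4 and Cor. 6.7.4.1 (geometric regularity and extension of
  the base field).
* H. Matsumura, *Commutative Ring Theory*, CUP 1986, §32 p. 255 (definition), §28 Lemma 1.
  [Matsumura1987]
-/

noncomputable section

open IsLocalRing TensorProduct IntermediateField

namespace Literature.AlgebraicGeometry.Resolution

universe u

/-! ## Descent of Noetherianity and regularity along faithfully flat maps -/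

/-- Noetherianity descends along a faithfully flat algebra (Stacks 033E via Mathlib's order
embedding of submodule lattices under faithfully flat base change). [cite: StacksProject, Tag 033E] -/
theorem isNoetherianRing_of_faithfullyFlat (R A : Type u) [CommRing R] [CommRing A] [Algebra R A]
    [Module.FaithfullyFlat R A] [IsNoetherianRing A] : IsNoetherianRing R := by
  have h : IsNoetherian A (A ⊗[R] R) :=
    isNoetherian_of_linearEquiv (TensorProduct.AlgebraTensorModule.rid R A A).symm
  exact Submodule.IsNoetherian.of_isNoetherian_tensorProduct_of_faithfullyFlat h

/-- **Stacks 07NG for a base change of fields**, without Noetherian hypothesis: for a field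
extension `L'/L` and an `L`-algebra `S`, if `L' ⊗_L S` is regular then so is `S`
(`S → S ⊗_L L'` is faithfully flat; Noetherianity descends too). [cite: StacksProject, Tag 07NG] -/
theorem isRegularRing_of_isRegularRing_baseChange_field' (L L' S : Type u) [Field L] [Field L']
    [Algebra L L'] [CommRing S] [Algebra L S] [IsRegularRing (L' ⊗[L] S)] : IsRegularRing S := by
  haveI : IsNoetherianRing (S ⊗[L] L') :=
    isNoetherianRing_of_ringEquiv _ (Algebra.TensorProduct.comm L L' S).toRingEquiv
  haveI : IsNoetherianRing S := isNoetherianRing_of_faithfullyFlat S (S ⊗[L] L')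
  exact isRegularRing_of_isRegularRing_baseChange_field L L' S

/-! ## Rational function fields: `l(s) ⊗_l G` is regular for `G` regular -/

/-- For a field `l`, a finite type `ι` and a regular `l`-algebra `G`, the ring
`l(X_ι) ⊗_l G` (`l(X_ι)` the fraction field of `l[X_ι]`) is regular: it is a localisation of
`l[X_ι] ⊗_l G ≅ G[X_ι]`, which is regular (Mathlib: polynomial rings over regular rings are
regular). [folklore] -/
theorem isRegularRing_fractionRing_mvPolynomial_tensor (l : Type u) [Field l] (ι : Type u)
    [Finite ι] (G : Type u) [CommRing G] [Algebra l G] [IsRegularRing G] :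
    IsRegularRing (FractionRing (MvPolynomial ι l) ⊗[l] G) := by
  set P := MvPolynomial ι l
  set Q := FractionRing (MvPolynomial ι l)
  -- `P ⊗_l G ≅ G[X_ι]` is regular
  haveI : IsRegularRing (P ⊗[l] G) :=
    IsRegularRing.of_ringEquiv (R := MvPolynomial ι G)
      ((Algebra.TensorProduct.comm l P G).toRingEquiv.trans
        (MvPolynomial.algebraTensorAlgEquiv (σ := ι) l G).toRingEquiv).symm
  -- `(P ⊗_l G) ⊗_P Q` is a localisation of `P ⊗_l G`
  haveI : IsLocalization (Algebra.algebraMapSubmonoid (P ⊗[l] G) (nonZeroDivisors P))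
      ((P ⊗[l] G) ⊗[P] Q) := IsLocalization.tensor Q (nonZeroDivisors P)
  haveI : IsRegularRing ((P ⊗[l] G) ⊗[P] Q) :=
    isRegularRing_of_isLocalization (Algebra.algebraMapSubmonoid (P ⊗[l] G) (nonZeroDivisors P)) _
  -- `≅ Q ⊗_P (P ⊗_l G) ≅ Q ⊗_l G`
  exact IsRegularRing.of_ringEquiv (R := (P ⊗[l] G) ⊗[P] Q)
    ((Algebra.TensorProduct.comm P (P ⊗[l] G) Q).toRingEquiv.trans
      (Algebra.TensorProduct.cancelBaseChange l P Q Q G).toRingEquiv)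

/-! ## Stacks 0381: finitely generated extensions of the ground field -/

section FG

variable {k F : Type u} [Field k] [CommRing F] [Algebra k F]

/-- Step "`l(s) ⊗_k F = l(s) ⊗_l (l ⊗_k F)` is regular": for a field `E` isomorphic over `l` to a
rational function field `l(X_ι)` (`ι` finite), if `l ⊗_k F` is regular then so is `E ⊗_k F`.
[folklore] -/
theorem isRegularRing_tensor_of_algEquiv_fractionRing (l E : Type u) [Field l] [Algebra k l]
    [Field E] [Algebra l E] [Algebra k E] [IsScalarTower k l E] {ι : Type u} [Finite ι]
    (e₀ : FractionRing (MvPolynomial ι l) ≃ₐ[l] E) [IsRegularRing (l ⊗[k] F)] :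
    IsRegularRing (E ⊗[k] F) := by
  haveI : IsRegularRing (FractionRing (MvPolynomial ι l) ⊗[l] (l ⊗[k] F)) :=
    isRegularRing_fractionRing_mvPolynomial_tensor l ι (l ⊗[k] F)
  haveI : IsRegularRing (E ⊗[l] (l ⊗[k] F)) :=
    IsRegularRing.of_ringEquiv (R := FractionRing (MvPolynomial ι l) ⊗[l] (l ⊗[k] F))
      (Algebra.TensorProduct.congr e₀ (AlgEquiv.refl (R := l) (A₁ := l ⊗[k] F))).toRingEquiv
  exact IsRegularRing.of_ringEquiv (R := E ⊗[l] (l ⊗[k] F))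
    (Algebra.TensorProduct.cancelBaseChange k l E E F).toRingEquiv

/-- Steps "`L' ⊗_k F = L' ⊗_E (E ⊗_k F)` is regular" (finite separable `L'/E`) and "regularity
descends from `L' ⊗_k F = L' ⊗_L (L ⊗_k F)` to `L ⊗_k F`". [folklore] -/
theorem isRegularRing_tensor_of_isSeparable_of_descent (E L' L : Type u) [Field E] [Algebra k E]
    [Field L'] [Algebra E L'] [Algebra k L'] [IsScalarTower k E L'] [Field L] [Algebra k L]
    [Algebra L L'] [IsScalarTower k L L'] [Module.Finite E L'] [Algebra.IsSeparable E L']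
    [IsRegularRing (E ⊗[k] F)] : IsRegularRing (L ⊗[k] F) := by
  haveI : IsRegularRing (L' ⊗[E] (E ⊗[k] F)) :=
    IsRegularRing.tensorProduct_of_isSeparable_left E (E ⊗[k] F) L'
  haveI : IsRegularRing (L' ⊗[k] F) :=
    IsRegularRing.of_ringEquiv (R := L' ⊗[E] (E ⊗[k] F))
      (Algebra.TensorProduct.cancelBaseChange k E L' L' F).toRingEquiv
  haveI : IsRegularRing (L' ⊗[L] (L ⊗[k] F)) :=
    IsRegularRing.of_ringEquiv (R := L' ⊗[k] F)
      (Algebra.TensorProduct.cancelBaseChange k L L' L' F).symm.toRingEquiv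
  exact isRegularRing_of_isRegularRing_baseChange_field' L L' (L ⊗[k] F)

/-- **Geometric regularity survives finitely generated extensions of the ground field** (Stacks
0381, (2)/(Matsumura's definition) ⇒ (1); EGA IV₂ 6.7.4): if `k' ⊗_k F` is regular for every
finite extension `k'/k`, then `L ⊗_k F` is regular for every finitely generated field extension
`L/k`. See the module docstring for the proof. [cite: StacksProject, Tag 0381] -/
theorem IsGeometricallyRegular.isRegularRing_baseChange_of_fg (hF : IsGeometricallyRegular k F)
    (L : Type u) [Field L] [Algebra k L] (hL : (⊤ : IntermediateField k L).FG) :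
    IsRegularRing (L ⊗[k] F) := by
  classical
  obtain ⟨L', _i₁, _i₂, _i₃, _i₄, hfin, -, l, hlfin, -, -, ⟨s, hind, hsep⟩, -⟩ :=
    exists_purelyInseparable_isSeparablyGenerated k L hL
  haveI := hfin
  haveI : Module.Finite k l := hlfin
  -- Step 1: `l ⊗_k F` is regular
  haveI : IsRegularRing (l ⊗[k] F) := hF l inferInstance
  -- Step 2: `E = l(s) ≅ l(X_s)`, so `E ⊗_k F` is regular
  let E : IntermediateField l L' := IntermediateField.adjoin l (s : Set L')
  have hrange : IntermediateField.adjoin l (Set.range ((↑) : s → L')) = E := by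
    simp only [E, Subtype.range_coe_subtype, Finset.setOf_mem]
  let e₀ : FractionRing (MvPolynomial s l) ≃ₐ[l] E :=
    hind.aevalEquivField.trans (IntermediateField.equivOfEq hrange)
  haveI : IsRegularRing (E ⊗[k] F) := isRegularRing_tensor_of_algEquiv_fractionRing l E e₀
  -- Step 3: `L'/E` is finite separable; Step 4: descend to `L`
  haveI : IsScalarTower k E L' := IsScalarTower.of_algebraMap_eq fun x => by
    have h1 : algebraMap k E x = algebraMap l E (algebraMap k l x) :=
      IsScalarTower.algebraMap_apply k l E x
    rw [h1, ← IsScalarTower.algebraMap_apply l E L', ← IsScalarTower.algebraMap_apply k l L']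
  haveI : Algebra.IsSeparable E L' := hsep
  haveI : Algebra.EssFiniteType k L := IntermediateField.fg_top_iff.mp hL
  haveI : Algebra.EssFiniteType L L' := inferInstance
  haveI : Algebra.EssFiniteType k L' := Algebra.EssFiniteType.comp k L L'
  haveI : Algebra.EssFiniteType E L' := Algebra.EssFiniteType.of_comp k E L'
  haveI : Module.Finite E L' := Algebra.finite_of_essFiniteType_of_isAlgebraic
  exact isRegularRing_tensor_of_isSeparable_of_descent E L' L

/-- **Stacks 0381, geometric form**: for `F` geometrically regular over `k` and `L/k` a finitely
generated field extension, `L ⊗_k F` is geometrically regular over `L` (finite extensions of `L`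
are finitely generated over `k`). [cite: StacksProject, Tag 0381] -/
theorem IsGeometricallyRegular.baseChange_of_fg (hF : IsGeometricallyRegular k F) (L : Type u)
    [Field L] [Algebra k L] (hL : (⊤ : IntermediateField k L).FG) :
    IsGeometricallyRegular L (L ⊗[k] F) := by
  intro L₂ _ _ hL₂
  haveI := hL₂
  letI : Algebra k L₂ := ((algebraMap L L₂).comp (algebraMap k L)).toAlgebra
  haveI : IsScalarTower k L L₂ := IsScalarTower.of_algebraMap_eq fun _ => rfl
  have hL₂fg : (⊤ : IntermediateField k L₂).FG := by
    rw [IntermediateField.fg_top_iff] at hL ⊢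
    exact Algebra.EssFiniteType.comp k L L₂
  haveI := hF.isRegularRing_baseChange_of_fg L₂ hL₂fg
  exact IsRegularRing.of_ringEquiv (R := L₂ ⊗[k] F)
    (Algebra.TensorProduct.cancelBaseChange k L L₂ L₂ F).symm.toRingEquiv

end FG

/-! ## Stacks 07C1: base change along essentially finite type maps -/

section BaseChange

variable {A B : Type u} [CommRing A] [CommRing B] [Algebra A B]

/-- **Stacks 07C1** (Lemma 15.42.3) for an essentially finite type base change: if `B` is regular
over `A` (`B` Noetherian) and `A'` is essentially of finite type over `A`, then `A' ⊗_A B` is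
regular over `A'`. Flatness is base change; the fibre over a prime `P'` of `A'` over `P`,
base-changed to a finite extension `L` of `κ(P')`, is `L ⊗_{κ(P)} (κ(P) ⊗_A B)` with `L/κ(P)`
finitely generated (`κ(P')/κ(P)` is essentially of finite type), regular by Stacks 0381
(`IsGeometricallyRegular.isRegularRing_baseChange_of_fg`). [cite: StacksProject, Tag 07C1] -/
theorem IsRegularHom.baseChange_of_essFiniteType [IsNoetherianRing B] (h : IsRegularHom A B)
    (A' : Type u) [CommRing A'] [Algebra A A'] [Algebra.EssFiniteType A A'] :
    IsRegularHom A' (A' ⊗[A] B) := by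
  haveI : Module.Flat A B := h.1
  refine ⟨inferInstance, fun P' _ => ?_⟩
  intro L _ _ hL
  haveI := hL
  -- `P = P' ∩ A`, the tower `κ(P) → κ(P') → L`
  let P : Ideal A := P'.under A
  letI := Localization.AtPrime.algebraOfLiesOver P P'
  haveI : Algebra.EssFiniteType P.ResidueField P'.ResidueField := inferInstance
  letI : Algebra P.ResidueField L :=
    ((algebraMap P'.ResidueField L).comp (algebraMap P.ResidueField P'.ResidueField)).toAlgebra
  haveI : IsScalarTower P.ResidueField P'.ResidueField L :=
    IsScalarTower.of_algebraMap_eq fun _ => rfl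
  haveI : Algebra.EssFiniteType P'.ResidueField L := inferInstance
  haveI : Algebra.EssFiniteType P.ResidueField L :=
    Algebra.EssFiniteType.comp P.ResidueField P'.ResidueField L
  have hfg : (⊤ : IntermediateField P.ResidueField L).FG := IntermediateField.fg_top_iff.mpr ‹_›
  -- `L` as an `A'`-algebra and as an `A`-algebra
  letI : Algebra A' L := ((algebraMap P'.ResidueField L).comp (algebraMap A' P'.ResidueField)).toAlgebra
  haveI : IsScalarTower A' P'.ResidueField L := IsScalarTower.of_algebraMap_eq fun _ => rfl
  letI : Algebra A L := ((algebraMap P.ResidueField L).comp (algebraMap A P.ResidueField)).toAlgebra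
  haveI : IsScalarTower A P.ResidueField L := IsScalarTower.of_algebraMap_eq fun _ => rfl
  haveI : IsScalarTower A A' L := by
    refine IsScalarTower.of_algebraMap_eq fun a => ?_
    change algebraMap P'.ResidueField L (algebraMap P.ResidueField P'.ResidueField
        (algebraMap A P.ResidueField a)) =
      algebraMap P'.ResidueField L (algebraMap A' P'.ResidueField (algebraMap A A' a))
    rw [← IsScalarTower.algebraMap_apply A P.ResidueField P'.ResidueField,
      ← IsScalarTower.algebraMap_apply A A' P'.ResidueField]
  -- the fibre over `P`, base-changed to the finitely generated `L`, is regular (Stacks 0381)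
  haveI : IsNoetherianRing (P.ResidueField ⊗[A] B) := isNoetherianRing_fiber' (C := B) P
  haveI hreg : IsRegularRing (L ⊗[P.ResidueField] (P.ResidueField ⊗[A] B)) :=
    (h.2 P).isRegularRing_baseChange_of_fg L hfg
  let e₁ : L ⊗[P.ResidueField] (P.ResidueField ⊗[A] B) ≃ₐ[L] L ⊗[A] B :=
    Algebra.TensorProduct.cancelBaseChange A P.ResidueField L L B
  let e₂ : L ⊗[P'.ResidueField] (P'.ResidueField ⊗[A'] (A' ⊗[A] B)) ≃ₐ[L]
      L ⊗[A'] (A' ⊗[A] B) :=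
    Algebra.TensorProduct.cancelBaseChange A' P'.ResidueField L L (A' ⊗[A] B)
  let e₃ : L ⊗[A'] (A' ⊗[A] B) ≃ₐ[L] L ⊗[A] B :=
    Algebra.TensorProduct.cancelBaseChange A A' L L B
  exact IsRegularRing.of_ringEquiv (R := L ⊗[P.ResidueField] (P.ResidueField ⊗[A] B))
    (e₁.toRingEquiv.trans (e₂.toRingEquiv.trans e₃.toRingEquiv).symm)

end BaseChange

end Literature.AlgebraicGeometry.Resolution

end
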